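import Summits.BirchSwinnertonDyer.BirchSwinnertonDyer.Theorems.ByReductionTypeAtTwoOrdKatoOptimalLedger
import Summits.BirchSwinnertonDyer.BirchSwinnertonDyer.Theorems.ByReductionTypeAtTwoMultLowerHalfDescent
import Summits.BirchSwinnertonDyer.Rank1Residual.X5.TwoAdicInstancesToolkitB
import Summits.BirchSwinnertonDyer.Rank1Residual.X5.TwoAdicInstancesToolkitD
import Literature.NumberTheory.EllipticCurves.TwoAdicImageSurjectivityModTwoProofs
import Literature.NumberTheory.EllipticCurves.ComplexMultiplicationRationalJIntegralProofs
import Literature.NumberTheory.EllipticCurves.ComplexMultiplicationTwistIsogenyProofs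
import HarnessLib

/-!
# Route ByReductionTypeAtTwo, cruxes `OrdKatoHalfAtTwoIso` (stmt-BirchSwinnertonDyer-19573) /
# `OrdKatoHalfAtTwo` (19271): the «ORD-RED» CLASS-INSTANCE KIT — one-line doors for the per-class display
# files on the `E[2]`-REDUCIBLE good-ordinary block (planner RC-140 (2); seat `bsd-2adic-ord` GEN 11)

HONEST FRAMING (cell `bsd-2adic`, run/shared/lean/pub/bsd-2adic/, HUMAN RULINGS D-0036 / D-0054 / D-0074):
THEOREMS ONLY (no definition, no named fact, no instance); nothing asserted; nothing booked; BSD is not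
proved by any of this. PARTITION: X5@2 good-ord, `E[2]`-REDUCIBLE sub-block (B1·O1; the 14 `open2tors`
classes of `plan/offer-tower/OPEN65-after-R684.v2.tsv` + the 83 α-go + any other class with a rational point
of order `2`) × `p = 2` — types-the-object-of (the class-instance shape of items 19573 / 19271 on that
sub-block through MEMO-7's door); closes none.

The per-class door of record is GEN 10's
`OrdKatoOptimalAtTwo.bsdp_two_of_binder_of_pub_of_missingLowerBoundAt` (p524580; audit-2 BY-NAME pre-stage
`HOME/audit/D-NOTE-ORDRED-v0-byname-prestage-at-2.md` @d6b7d70dfcfc7341, planner RC-141 (3)). This kit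
rewrites it ONCE in the grammar a class file displays, so that every class file is curve data + one term:

* the ONE memo-tier token `hB7 : KatoMuPartAtOptimalMemberOfNotSurjectiveTwo` (`@[conjecture]`, p523509;
  MEMO-7 Thm D / D-C₃, cell-referee RC-D PASS 15/15) — inside it lives the Kato-optimal member `W•`
  (`∃ W′` isogenous to `W`): NO per-class identification of `W•` is needed or claimed, the door transports
  back to the displayed member by Cassels + ord-2's isogeny lemma (MEMO-7 §3, RC-140 (2)(c));
* PUB by name {`hmod`, `hGZK`, `hCassels`} and PRINT-at-2 by name {`h17` = Kato 17.4 (1)(2) at 2 in its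
  `∀`-form, `hGr` = Greenberg Thm. 4.1 parity-free at 2} — the route bundle `OrdPublishedInputsAtTwo` is
  the conjunction `⟨hmod, hGZK, h17, hGr⟩` (defeq);
* RECORD {`hr : r_an = 0`}; KERNEL-DECIDABLE per curve {`¬ CM` (non-integral `j`), `GoodOrd W 2`,
  a rational point of order `2` given by its abscissa: `HasRationalTwoTorsionX W x` ⇒ `ρ̄_{W,2}` not onto
  by Dokchitser–Dokchitser (1), kernel theorem `hasSurjectiveModNGaloisRep_two_iff`};
* CERT, in the cell's two currencies: either `hlow : MissingLowerBoundAt W 2` displayed, or the T4 grammar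
  RECORD `hShaAn : #Ш_an = q` + CERT `hdvd : 2^m ∣ #Ш` with `ord₂ q ≤ m` (CERT-CT2-X5ALL `m = 4` /
  CERT-L3-CT42 `m = 6`), through `missingLowerBoundAt_of_rankZero_of_pow_dvd`.

Contents: `not_hasSurjectiveModNGaloisRep_two_of_hasRationalTwoTorsionX`, `…_of_isSquare_Δ` (the C₃
species), `not_hasCM_baseChange_int_of_not_dvd_c₄_pow` (twin of the ss kit's lemma, re-proved here to
keep the import cone small), and the four doors `exists_isIsogenous_…_ordRed` (item 19573 AT the member:
binder + `h17` only), `mainConjectureLowerDivisibilityAtTwoOrd_ordRed` (item 19271 AT the member, MEMO-7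
Cor. D2), `bsdp_two_ordRed_of_missingLowerBoundAt`, `bsdp_two_ordRed_of_pow_dvd`.
References: [Kato2004Asterisque] Thm. 17.4 (1)(2); [GreenbergLNM1716] Thm. 4.1, p. 170;
[DokchitserDokchitserMathZ2012] Theorem (1); [SilvermanATAEC1994] Thm. II.6.1; [Miller2011LMS] Def. 1.1;
[Wuthrich2014] Thm. 16 (shape, p odd).
-/

set_option autoImplicit false
-- the sub-problem namespace repeats the summit name by design (D-0017 nested layout)
set_option linter.dupNamespace false

noncomputable section

open scoped Classical MatrixGroups ModularForm

open CongruenceSubgroup WeierstrassCurve Literature.NumberTheory.EllipticCurves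
  Literature.NumberTheory.EllipticCurves.ModularForms
  Literature.NumberTheory.EllipticCurves.Rank1Residual
  Literature.NumberTheory.EllipticCurves.Rank1Residual.Typed
  Literature.NumberTheory.EllipticCurves.Greenberg1999
  Summit.BirchSwinnertonDyer.Rank1Residual.X5
  Summit.BirchSwinnertonDyer.Rank1Residual.X5.Instances
  Summit.BirchSwinnertonDyer.BirchSwinnertonDyer.Theorems.OrdKatoIntAtTwo
  Summit.BirchSwinnertonDyer.BirchSwinnertonDyer.Theorems.OrdKatoOptimalAtTwo

namespace Summit.BirchSwinnertonDyer.BirchSwinnertonDyer.Theorems.OrdRedAtTwo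

/-! ## §1 Kernel-decidable legs: `ρ̄_{W,2}` not onto, no CM -/

/-- **A rational point of order `2` (given by its abscissa) makes `ρ̄_{W,2}` NON-surjective**:
`HasRationalTwoTorsionX W x` gives a point `T ∈ E(ℚ)` of order exactly `2`
(`Instances.exists_point_addOrderOf_eq_two`), and Dokchitser–Dokchitser (1) (kernel theorem
`hasSurjectiveModNGaloisRep_two_iff`) says a surjective `ρ̄₂` admits no such point.
[cite: DokchitserDokchitserMathZ2012, Theorem (1) (p. 961)] -/
theorem not_hasSurjectiveModNGaloisRep_two_of_hasRationalTwoTorsionX (W : WeierstrassCurve ℚ) [W.IsElliptic]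
    {x : ℚ} (hx : HasRationalTwoTorsionX W x) : ¬ W.HasSurjectiveModNGaloisRep 2 := by
  intro hs
  obtain ⟨T, hT⟩ := exists_point_addOrderOf_eq_two hx
  have h2T : 2 • T = 0 := by rw [← hT]; exact addOrderOf_nsmul_eq_zero T
  have hT0 : T ≠ 0 := by
    intro h0
    rw [h0, addOrderOf_zero] at hT
    exact absurd hT (by norm_num)
  exact hT0 (((hasSurjectiveModNGaloisRep_two_iff W).mp hs).1 T h2T)

/-- **A square discriminant makes `ρ̄_{W,2}` NON-surjective** (image inside `A₃ = C₃`; the C₃ species of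
MEMO-7 Thm D-C₃): Dokchitser–Dokchitser (1), second conjunct. [cite: DokchitserDokchitserMathZ2012, Theorem (1) (p. 961)] -/
theorem not_hasSurjectiveModNGaloisRep_two_of_isSquare_Δ (W : WeierstrassCurve ℚ) [W.IsElliptic]
    (hΔ : IsSquare W.Δ) : ¬ W.HasSurjectiveModNGaloisRep 2 :=
  fun hs ↦ ((hasSurjectiveModNGaloisRep_two_iff W).mp hs).2 hΔ

/-- **No CM from a non-integral `j`-invariant, integer-model form** (twin of the ss kit's
`SSColemanRoad.not_hasCM_baseChange_int_of_not_dvd`, re-proved to keep this kit's imports small): if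
`Δ(M) ∤ c₄(M)³` then `j = c₄³/Δ ∉ ℤ`, whereas a CM curve over `ℚ` has integral `j`.
[cite: SilvermanATAEC1994, Thm. II.6.1 (PDF p. 139)] -/
theorem not_hasCM_baseChange_int_of_not_dvd_c₄_pow (M : WeierstrassCurve ℤ) [(M.baseChange ℚ).IsElliptic]
    (h : ¬ M.Δ ∣ M.c₄ ^ 3) : ¬ (M.baseChange ℚ).HasCM := fun hCM ↦ by
  obtain ⟨n, hn⟩ := (M.baseChange ℚ).exists_intCast_eq_j_of_hasCM hCM
  rw [j_eq_c₄_pow_div, baseChange_int_c₄, baseChange_int_Δ] at hn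
  have hD : (M.Δ : ℚ) ≠ 0 := by
    have := (M.baseChange ℚ).isUnit_Δ.ne_zero
    rwa [baseChange_int_Δ] at this
  have h' : (n : ℚ) * M.Δ = (M.c₄ : ℚ) ^ 3 := by rw [hn]; field_simp
  have h'' : n * M.Δ = M.c₄ ^ 3 := by exact_mod_cast h'
  exact h ⟨n, by rw [← h'']; ring⟩

/-! ## §2 The ORD-RED doors in display grammar -/

variable (W : WeierstrassCurve ℚ) [W.IsElliptic] [W.IsGloballyMinimal]

/-- **Item `OrdKatoHalfAtTwoIso` (19573) AT a curve with a rational point of order `2`** — MEMO-7 Cor. D1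
at a class: the memo binder `hB7` (the Kato-optimal member lives inside it) + PRINT `h17` (Kato 17.4 (1)(2)
at `2`, `∀`-form) + KERNEL {`¬ CM`, `GoodOrd W 2`, `HasRationalTwoTorsionX W x`} ⇒ `∃ W′` isogenous with
`MainConjectureLowerDivisibilityAtTwoOrd W′`. No analytic rank, no certificate. [cite: Kato2004Asterisque, Thm. 17.4 (1)(2) (p. 273)] -/
theorem exists_isIsogenous_mainConjectureLowerDivisibilityAtTwoOrd_ordRed
    (hB7 : KatoMuPartAtOptimalMemberOfNotSurjectiveTwo)
    (h17 : ∀ (V : WeierstrassCurve ℚ) [V.IsElliptic] [V.IsGloballyMinimal] [NeZero (V.conductorNorm ℤ)]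
      (f : CuspForm (Gamma0 (V.conductorNorm ℤ)) 2), kato_divisibility_allPrimes V 2 (f := f))
    (hcm : ¬ W.HasCM) (hgo : GoodOrd W 2) {x : ℚ} (hx : HasRationalTwoTorsionX W x) :
    ∃ (W' : WeierstrassCurve ℚ) (_ : W'.IsElliptic) (_ : W'.IsGloballyMinimal),
      IsIsogenous W W' ∧ O1.MainConjectureLowerDivisibilityAtTwoOrd W' :=
  exists_isIsogenous_mainConjectureLowerDivisibilityAtTwoOrd_of_binder W hB7 h17 hcm hgo
    (not_hasSurjectiveModNGaloisRep_two_of_hasRationalTwoTorsionX W hx)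

/-- **Item `OrdKatoHalfAtTwo` (19271) AT THE DISPLAYED MEMBER — MEMO-7 Cor. D2 at a class**: binder `hB7` +
PUB/PRINT by name {`hmod`, `hGZK`, `h17`, `hGr`, `hCassels`} + RECORD `hr` + KERNEL {`¬ CM`, `GoodOrd W 2`,
`HasRationalTwoTorsionX W x`} ⇒ `O1.MainConjectureLowerDivisibilityAtTwoOrd W` (SHARP Kato half at `W`
itself: `μ(X(E/ℚ_∞)) ≤ μ(ϖ_E·L₂(f,α))`, the Kato direction of Greenberg's `μ_E = m_E` at `2`). No certificate.
[cite: GreenbergLNM1716, Thm. 4.1 (p. 102) and p. 170] [cite: Kato2004Asterisque, Thm. 17.4 (1)(2) (p. 273)] -/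
theorem mainConjectureLowerDivisibilityAtTwoOrd_ordRed
    (hB7 : KatoMuPartAtOptimalMemberOfNotSurjectiveTwo)
    (hmod : nonempty_modularParametrizationData) (hGZK : rank_eq_analyticRank_of_analyticRank_le_one)
    (h17 : ∀ (V : WeierstrassCurve ℚ) [V.IsElliptic] [V.IsGloballyMinimal] [NeZero (V.conductorNorm ℤ)]
      (f : CuspForm (Gamma0 (V.conductorNorm ℤ)) 2), kato_divisibility_allPrimes V 2 (f := f))
    (hGr : Greenberg1999.thm41_charValue_rankZero_anyPrime) (hCassels : bsdRHS_eq_of_isIsogenous)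
    (hcm : ¬ W.HasCM) (hr : W.analyticRank = 0) (hgo : GoodOrd W 2) {x : ℚ}
    (hx : HasRationalTwoTorsionX W x) : O1.MainConjectureLowerDivisibilityAtTwoOrd W :=
  mainConjectureLowerDivisibilityAtTwoOrd_of_binder_of_pub W hB7 ⟨hmod, hGZK, h17, hGr⟩ hCassels hcm hr hgo
    (not_hasSurjectiveModNGaloisRep_two_of_hasRationalTwoTorsionX W hx)

/-- **`BSD(E,2)` ON THE ORD-RED ROAD, descent certificate displayed as `hlow`**: binder `hB7` + PUB/PRINT by
name + RECORD `hr` + KERNEL {`¬ CM`, `GoodOrd W 2`, rational `2`-torsion abscissa} + CERT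
`hlow : MissingLowerBoundAt W 2` ⇒ `BSDp W 2`, through the door of record
`OrdKatoOptimalAtTwo.bsdp_two_of_binder_of_pub_of_missingLowerBoundAt`. No `λ`/`μ` certificate, no tower
count, no Prop-5.14 point, no Schneider. [cite: Miller2011LMS, Def. 1.1 and §1]
[cite: GreenbergLNM1716, Thm. 4.1 (p. 102)] [cite: Kato2004Asterisque, Thm. 17.4 (1)(2) (p. 273)] -/
theorem bsdp_two_ordRed_of_missingLowerBoundAt
    (hB7 : KatoMuPartAtOptimalMemberOfNotSurjectiveTwo)
    (hmod : nonempty_modularParametrizationData) (hGZK : rank_eq_analyticRank_of_analyticRank_le_one)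
    (h17 : ∀ (V : WeierstrassCurve ℚ) [V.IsElliptic] [V.IsGloballyMinimal] [NeZero (V.conductorNorm ℤ)]
      (f : CuspForm (Gamma0 (V.conductorNorm ℤ)) 2), kato_divisibility_allPrimes V 2 (f := f))
    (hGr : Greenberg1999.thm41_charValue_rankZero_anyPrime) (hCassels : bsdRHS_eq_of_isIsogenous)
    (hcm : ¬ W.HasCM) (hr : W.analyticRank = 0) (hgo : GoodOrd W 2) {x : ℚ}
    (hx : HasRationalTwoTorsionX W x) (hlow : MissingLowerBoundAt W 2) : BSDp W 2 :=
  bsdp_two_of_binder_of_pub_of_missingLowerBoundAt W hB7 ⟨hmod, hGZK, h17, hGr⟩ hCassels hcm hr hgo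
    (not_hasSurjectiveModNGaloisRep_two_of_hasRationalTwoTorsionX W hx) hlow

/-- **`BSD(E,2)` ON THE ORD-RED ROAD, T4 descent grammar**: as above with the descent inequality produced from
the RECORD `hShaAn : #Ш_an = q` (`ord₂ q ≤ m`, arithmetic `hv`) and the CERTIFICATE `hdvd : 2^m ∣ #Ш`
(ENGINE CT-2 / PARI `ellrank`, CERT-CT2-X5ALL: `m = 4`; CERT-L3-CT42: `m = 6`) via
`missingLowerBoundAt_of_rankZero_of_pow_dvd` (finiteness of `Ш` from GZK at analytic rank `0`).
[cite: Miller2011LMS, Def. 1.1 and §1] [cite: GreenbergLNM1716, Thm. 4.1 (p. 102)]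
[cite: Kato2004Asterisque, Thm. 17.4 (1)(2) (p. 273)] -/
theorem bsdp_two_ordRed_of_pow_dvd
    (hB7 : KatoMuPartAtOptimalMemberOfNotSurjectiveTwo)
    (hmod : nonempty_modularParametrizationData) (hGZK : rank_eq_analyticRank_of_analyticRank_le_one)
    (h17 : ∀ (V : WeierstrassCurve ℚ) [V.IsElliptic] [V.IsGloballyMinimal] [NeZero (V.conductorNorm ℤ)]
      (f : CuspForm (Gamma0 (V.conductorNorm ℤ)) 2), kato_divisibility_allPrimes V 2 (f := f))
    (hGr : Greenberg1999.thm41_charValue_rankZero_anyPrime) (hCassels : bsdRHS_eq_of_isIsogenous)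
    (hcm : ¬ W.HasCM) (hr : W.analyticRank = 0) (hgo : GoodOrd W 2) {x : ℚ}
    (hx : HasRationalTwoTorsionX W x) {q : ℚ} (hShaAn : shaAn W = (q : ℂ)) {m : ℕ}
    (hv : padicValRat 2 q ≤ m) (hdvd : 2 ^ m ∣ W.shaOrder) : BSDp W 2 :=
  bsdp_two_ordRed_of_missingLowerBoundAt W hB7 hmod hGZK h17 hGr hCassels hcm hr hgo hx
    (missingLowerBoundAt_of_rankZero_of_pow_dvd W 2 hGZK hr hShaAn hv hdvd)

end Summit.BirchSwinnertonDyer.BirchSwinnertonDyer.Theorems.OrdRedAtTwo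

end
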